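import Mathlib

/-!
# Wall siege, round 2 — new certificate-shaped sub-stubs for `stub_tangencySets` (stmt-MatrixMultiplication-14080)

Planner seat `planner-sgplan-stmt-MatrixMultiplication-14080-wall-plan-0`, 2026-08-16 (after kit j018863).
Round 1 (`WallTangencySets.lean`, 13 sub-stubs) is ENTIRELY LANDED by the wallb / ccert seats:
`TangencyCertificates.stub_tangencyAt_{3_4,5_10,7_17,11_33,13_41}` (+ records `srs_recordAt_11_34`, `srs_recordAt_13_42`),
`UnitalBoundExact.stub_tangency_isw_bound`, `…stub_tangencyAt_{5_not_11,7_not_18}` (and `11_not_36, 13_not_46, 17_not_70,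
19_not_82, 23_not_109` from `srs_count_ineq`), seat 3's `stub_tangencyAt_3_not_5`, `ParabolaFreeInstances/Exact/Exact11`
(`α₇ = 10`, `α₁₁ = 23`).  Meanwhile the floor moved to exponent `3/2 − ε` for every `ε`
(`ParabolaLift.stubFormat_near_threeHalves[_progression|_allPrimes]`, Pohoata 2026 Thm 1.3 proved in the tree), so the wall is
now purely the CONSTANT at exponent `3/2`: windows `T(11) ∈ [34,35]`, `T(13) ∈ [42,45]`, `T(17) ∈ [59,69]`, `T(19) ∈ [69,81]`,
`T(23) ∈ [91,108]`.  This file files the next certificates: seven record lower bounds `p = 17 … 47` from kit j018863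
(simulated annealing and the Singer multicoset family — `p = 29, 37` are cyclic-symmetric constructions), the frontier
instance `T(11) ≤ 34` (truth unknown), and the exact parabola-free value `α₁₃ = 39` (both directions).
Witness lists: `witnesses_r2.json`, `parabolafree_p13.json` on the item; Lean validation: `WallTangencyChecksR2.lean`.
-/

namespace Summit.MatrixMultiplication.MatrixMultiplication.Cruxes.LevelOneGL2Designs.WallTangencyR2

open Matrix

/-- SUB-STUB (instance, round 2): `T(17) ≥ 59` (ratio 0.842 of p^{3/2}; ceiling from `srs_count_ineq`: see DECOMPOSITIONS.md §R).  Source: SA kit j018863 (seed random).  Witness: `witnesses_r2.json` ["17"] on the item (verified by `check_stub` and by `native_decide` in `WallTangencyChecksR2.lean`). -/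
theorem stub_tangencyAt_17_59 : ∃ S : Finset ((Fin 2 → ZMod 17) × (Fin 2 → ZMod 17)), 59 ≤ S.card ∧ ∀ f ∈ S, ∀ f' ∈ S, (dotProduct f.1 f'.2 = 1 ↔ f = f') := by
  sorry

/-- SUB-STUB (instance, round 2): `T(19) ≥ 69` (ratio 0.833 of p^{3/2}; ceiling from `srs_count_ineq`: see DECOMPOSITIONS.md §R).  Source: SA kit j018863 (seed vertexless-triangle).  Witness: `witnesses_r2.json` ["19"] on the item (verified by `check_stub` and by `native_decide` in `WallTangencyChecksR2.lean`). -/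
theorem stub_tangencyAt_19_69 : ∃ S : Finset ((Fin 2 → ZMod 19) × (Fin 2 → ZMod 19)), 69 ≤ S.card ∧ ∀ f ∈ S, ∀ f' ∈ S, (dotProduct f.1 f'.2 = 1 ↔ f = f') := by
  sorry

/-- SUB-STUB (instance, round 2): `T(23) ≥ 91` (ratio 0.825 of p^{3/2}; ceiling from `srs_count_ineq`: see DECOMPOSITIONS.md §R).  Source: SA kit j018863 (seed circle-pencil).  Witness: `witnesses_r2.json` ["23"] on the item (verified by `check_stub` and by `native_decide` in `WallTangencyChecksR2.lean`). -/
theorem stub_tangencyAt_23_91 : ∃ S : Finset ((Fin 2 → ZMod 23) × (Fin 2 → ZMod 23)), 91 ≤ S.card ∧ ∀ f ∈ S, ∀ f' ∈ S, (dotProduct f.1 f'.2 = 1 ↔ f = f') := by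
  sorry

/-- SUB-STUB (instance, round 2): `T(29) ≥ 128` (ratio 0.820 of p^{3/2}; ceiling from `srs_count_ineq`: see DECOMPOSITIONS.md §R).  Source: Singer multicoset kit j018863 (m=13, |J|=10, projective SRS 130) -> best affine chart.  Witness: `witnesses_r2.json` ["29"] on the item (verified by `check_stub` and by `native_decide` in `WallTangencyChecksR2.lean`). -/
theorem stub_tangencyAt_29_128 : ∃ S : Finset ((Fin 2 → ZMod 29) × (Fin 2 → ZMod 29)), 128 ≤ S.card ∧ ∀ f ∈ S, ∀ f' ∈ S, (dotProduct f.1 f'.2 = 1 ↔ f = f') := by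
  sorry

/-- SUB-STUB (instance, round 2): `T(31) ≥ 134` (ratio 0.776 of p^{3/2}; ceiling from `srs_count_ineq`: see DECOMPOSITIONS.md §R).  Source: SA kit j018863 (seed random).  Witness: `witnesses_r2.json` ["31"] on the item (verified by `check_stub` and by `native_decide` in `WallTangencyChecksR2.lean`). -/
theorem stub_tangencyAt_31_134 : ∃ S : Finset ((Fin 2 → ZMod 31) × (Fin 2 → ZMod 31)), 134 ≤ S.card ∧ ∀ f ∈ S, ∀ f' ∈ S, (dotProduct f.1 f'.2 = 1 ↔ f = f') := by
  sorry

/-- SUB-STUB (instance, round 2): `T(37) ≥ 187` (ratio 0.831 of p^{3/2}; ceiling from `srs_count_ineq`: see DECOMPOSITIONS.md §R).  Source: Singer multicoset kit j018863 (m=21, |J|=9, projective SRS 189) -> best affine chart.  Witness: `witnesses_r2.json` ["37"] on the item (verified by `check_stub` and by `native_decide` in `WallTangencyChecksR2.lean`). -/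
theorem stub_tangencyAt_37_187 : ∃ S : Finset ((Fin 2 → ZMod 37) × (Fin 2 → ZMod 37)), 187 ≤ S.card ∧ ∀ f ∈ S, ∀ f' ∈ S, (dotProduct f.1 f'.2 = 1 ↔ f = f') := by
  sorry

/-- SUB-STUB (instance, round 2): `T(47) ≥ 231` (ratio 0.717 of p^{3/2}; ceiling from `srs_count_ineq`: see DECOMPOSITIONS.md §R).  Source: SA kit j018863 (seed circle-pencil).  Witness: `witnesses_r2.json` ["47"] on the item (verified by `check_stub` and by `native_decide` in `WallTangencyChecksR2.lean`). -/
theorem stub_tangencyAt_47_231 : ∃ S : Finset ((Fin 2 → ZMod 47) × (Fin 2 → ZMod 47)), 231 ≤ S.card ∧ ∀ f ∈ S, ∀ f' ∈ S, (dotProduct f.1 f'.2 = 1 ↔ f = f') := by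
  sorry

/-- SUB-STUB (FRONTIER instance, round 2; truth UNKNOWN — this is the point): `T(11) ≤ 34`.  Known: `T(11) ≥ 34`
(`TangencyCertificates.srs_recordAt_11_34`, kernel `decide`) and `T(11) ≤ 35` (`UnitalBoundExact.stub_tangencyAt_11_not_36`
from `srs_count_ineq`).  Settling it EITHER way is informative: a 35-flag witness (report `stub-false` with the list) or an
UNSAT certificate for `cnf/taff_p11_N35.cnf` of kit j018863 (1320 flags, 15112 vars, 1.03 M clauses; kissat: UNKNOWN after
1800 s; the unit clause `x₁` is flag-transitivity of GL₂(𝔽₁₁) acting by `(a,b) ↦ (g a, g⁻ᵀ b)` and must be discharged in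
Lean or dropped) imported as LRAT.  Prescribed-symmetry search (Singer `m = 7`, `|J| ≤ 5`) is exhausted at 35 projective /
33 affine. -/
theorem stub_tangencyAt_11_not_35 : ¬ ∃ S : Finset ((Fin 2 → ZMod 11) × (Fin 2 → ZMod 11)), 35 ≤ S.card ∧ ∀ f ∈ S, ∀ f' ∈ S, (dotProduct f.1 f'.2 = 1 ↔ f = f') := by
  sorry

/-- SUB-STUB (instance, round 2, family P2-mod): `α₁₃ ≥ 39` — the exact maximum of a parabola-free set in `ℤ₁₃²`
(kit j018863 familyB, B&B with translation symmetry, 0.3 s; `39 = 3·13` is the product `ℤ₁₃ × C`, `C` a Paley coclique of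
size `ω(P₁₃) = 3`; Hoffman bound 46.9 = 13^{3/2}).  Witness: `({(0, 0), (12, 0), (12, 7), (12, 5), (11, 7), (11, 5), (11, 0), (10, 7), (10, 5), (10, 0), (9, 7), (9, 5), (9, 0), (8, 7), (8, 5), (8, 0), (7, 7), (7, 5), (7, 0), (6, 7), (6, 5), (6, 0), (5, 7), (5, 5), (5, 0), (4, 7), (4, 5), (4, 0), (3, 7), (3, 5), (3, 0), (2, 7), (2, 5), (2, 0), (1, 7), (1, 5), (1, 0), (0, 7), (0, 5)} : Finset (ZMod 13 × ZMod 13))`. -/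
theorem stub_parabolaFreeAt_13_39 : ∃ T : Finset (ZMod 13 × ZMod 13), 39 ≤ T.card ∧ ∀ t ∈ T, ∀ t' ∈ T, (t'.1 - t.1) ^ 2 = t.2 - t'.2 → t'.1 = t.1 := by
  sorry

/-- SUB-STUB (instance, negative, round 2): `α₁₃ ≤ 39` (B&B exact; the wallb machinery `ParabolaFreeExact.no_parabolaFree`
(`p ≤ 16`, `decide +kernel` on `refuteM 13 40 m`) is the intended certificate route, as for `α₇ = 10`, `α₁₁ = 23`). -/
theorem stub_parabolaFreeAt_13_not_40 : ¬ ∃ T : Finset (ZMod 13 × ZMod 13), 40 ≤ T.card ∧ ∀ t ∈ T, ∀ t' ∈ T, (t'.1 - t.1) ^ 2 = t.2 - t'.2 → t'.1 = t.1 := by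
  sorry

end Summit.MatrixMultiplication.MatrixMultiplication.Cruxes.LevelOneGL2Designs.WallTangencyR2
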